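import Summits.BirchSwinnertonDyer.Rank1Residual.ManinAdditive.TwistOrbitAtTwoA1OddDichotomy
import Literature.NumberTheory.EllipticCurves.ManinConstantQuadraticTwistAtTwoProofs
import Literature.NumberTheory.EllipticCurves.ModularDegreeQuadraticTwistValuation
import Literature.NumberTheory.EllipticCurves.ManinConstantQuadraticTwistAtTwoOrdinaryProofs
import HarnessLib

/-!
# Twist-orbit transport of the Manin constant — ADD-ON part 2/4 (`TwistOrbitAtTwoA2EvenTwist`) to the typer's landing of T-an-6 (files F1–F3 =
# HOME/an/Sketch-an4v5.lean 2d253c8874352f93): the prime-2 theorems THM I′, E-an-18r, S-an-14, E-an-20, E-an-21,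
# the E-an-17 degree dichotomy at odd `q`, and the closed `(q*, q, q²)` obligations (§§9–14 of the planner's
# leaf HOME/an/Leaf-TwistOrbitManinTransport.lean f491d1e88c8dc766, VERBATIM).

PROVENANCE / HOW TO LAND. Cell `bsd-f2-manin`, planner `bsd-f2-manin-an` g3. This file = exactly the
declarations of the leaf f491d1e88c8dc766 that are NOT in Sketch-an4v5 (the typer's F1–F3 source), in leaf
order, importing F1–F3 under the module names the typer announced (STATUS 18:40Z: `TwistOrbitManinStatements`
(p556717), `TwistOrbitDegreeIdentity`, `TwistOrbitManinTransportProof`) — adjust the three `import Summits.…`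
lines to the landed names. It was compiled on the farm as HOME/an/Addon-AtTwo-simulated.lean (= Sketch-an4v5
body with the cell namespace + this body): rc 0 · 0 err · 0 warn · 0 sorries; audit ok. It needs from F1–F3
only: `not_good_and_not_mult_of_sq_dvd_conductorNorm`, `u_sq_eq_one_of_smul_quadraticTwist_of_Δ`,
`deg_mul_c_sq_eq_of_pStar`, `maninConstant_dvd_mul_of_charTwist_gamma0`, `twistOrbitManinTransport_pStar`,
`commutingOrbitManinChain_pStar`, `orbitDegreeManinIdentity_pStar`, `maninEqOfNotDvdDegree_pStar_holds`,
`flipOrbitManinEq_pStar`, `twistPartnerDegreeBound_pStar`, `twistMinimalDegreeRoadTransport_pStar`,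
`orbitManinDefectLeOne_pStar`, the statement schemas, and `natAbs_eq_and_deg_eq_of_chain`; if the typer renamed
any of them (dedup), rename here too.  Split for the 400-line rule at the `section` boundaries
(`OddDichotomy` | `Closed` | `EvenTwist`+`ClosedEven` | `EvenDegree`+`ClosedEvenDegree` | `ExactAtTwo`).

RESULTS (all kernel-checked, no `sorry`, every `@[conjecture] def` closed by a hypothesis-free `_holds` or a
generic `_of_` theorem; statements, census numbers and references: the leaf's module docstring and
HOME/MEMO-an.md §§27–39; HOME/CANDIDATES.md rows E-an-17, E-an-18/18c/18v, E-an-18r/S-an-14, E-an-20, E-an-21).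
-/

noncomputable section

open scoped MatrixGroups ModularForm

open CongruenceSubgroup WeierstrassCurve
  Literature.NumberTheory.DiophantineGeometry
  Literature.NumberTheory.EllipticCurves
  Literature.NumberTheory.EllipticCurves.ModularForms

namespace Summit.BirchSwinnertonDyer.Rank1Residual.ManinAdditive

section EvenTwist

open IsDedekindDomain Rat.HeightOneSpectrum

/-! ## §10 THEOREM I′ — same-level twist orbits at `2`: `χ₋₄` (`d = −1`, `m = 4`, `4² ∣ N`) and
## `χ_{±8}` (`d = ±2`, `m = 8`, `8² ∣ N`): the `Γ₀` chain with the conductor-`2` defect `η = 2`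

For an even primitive quadratic character `χ` mod `m ∈ {4, 8}` one has `g(χ)² = 4d` (`−4`, `8`, `−8`:
`gaussSum_χ₄_ringHomComp_sq`, `gaussSum_χ₈_ringHomComp_sq`, `gaussSum_χ₈'_ringHomComp_sq`), i.e.
`g(χ) = 2s` with `s² = d` the geometric period scaling `Λ(W ⊗ χ_d) = s⁻¹ Λ_W` (Pal 2012 Lemma 3.1); so on
`Γ₀` the factor `g(χ)/s = 2` is LOST (Stevens' `η = 2`) and the §7 chain yields `c′ ∣ 2·ũ·c` instead of
`c′ ∣ ũ·c` (`ũ ∈ {1, 2}` the twist-minimality defect, `ũ¹² Δ(C) = d⁶ Δ(W)`).  Read in both directions on an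
orbit whose two members are both twist-minimal (`Δ(C) = d⁶Δ(W)`, `Δ(C′) = d⁶Δ(W′)` — at `d = −1` this is
`Δ` constant along the orbit, which holds on all 296 234 same-level `χ₋₄`-orbits of conductor `< 5·10⁵`):
`c′ ∣ 2c ∣ 4c′`, i.e. THE ODD PART OF THE MANIN CONSTANT IS INVARIANT and the `2`-part moves by at most one
step.  The exact `c′ = ±c` (E-an-10 THM I, E-an-8, E-imc-8) needs the `Γ₁`-lattice step S-an-9 and is NOT
claimed.  Inputs: the odd-`n` coefficient relations `LFunction_quadraticTwist_neg_one/two/neg_two_apply_of_odd`,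
`aₙ(W′) = 0 = χ(n)` at even `n` (`W′` additive at `2` from `m² ∣ N`), E-an-9's engine verbatim. -/

/-- **The Néron lattice along a `χ_d`-twist with `g(χ)² = 4d`: `g(χ) z ∈ Λ_W ⟹ 2ũ z ∈ Λ_C`.**  If
`u • (W ⊗ χ_d) = C` and `r¹² Δ(C) = d⁶ Δ(W)` then `u.u = ±r` and `Λ_C = ± r s⁻¹ Λ_W`, `s = g(χ)/2`.
[cite: Pal2012, Lemma 3.1] [cite: MontgomeryVaughan2007, Thm. 9.17 (PDF p. 232)] -/
theorem neronLattice_mem_of_twist_of_gaussSum_sq {W C : WeierstrassCurve ℚ} [W.IsElliptic]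
    {d : ℚ} (hd : d ≠ 0) (u : VariableChange ℚ) (hu : u • W.quadraticTwist d = C) {r : ℚ} (hr : r ≠ 0)
    (hΔ : r ^ 12 * C.Δ = d ^ 6 * W.Δ) {G : ℂ} (hG : G ^ 2 = 4 * (d : ℂ))
    {L LC : PeriodPair} (hL : IsNeronLatticeOf (W.baseChange ℂ) L)
    (hLC : IsNeronLatticeOf (C.baseChange ℂ) LC) (z : ℂ) (hz : G * z ∈ L.lattice) :
    (2 * ((r : ℚ) : ℂ)) * z ∈ LC.lattice := by
  have hs2 : (G / 2) ^ 2 = (d : ℂ) := by rw [div_pow, hG]; ring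
  have hd0 : (d : ℂ) ≠ 0 := by exact_mod_cast hd
  have hs0 : G / 2 ≠ 0 := fun h0 ↦ hd0 (by rw [← hs2, h0]; simp)
  have hLT : IsNeronLatticeOf ((W.quadraticTwist d).baseChange ℂ) (L.mulLeft (G / 2)⁻¹ (inv_ne_zero hs0)) :=
    WeierstrassCurve.isNeronLatticeOf_quadraticTwist_of_sq_eq d hL hs0 hs2
  have hLC' : IsNeronLatticeOf ((u • W.quadraticTwist d).baseChange ℂ) LC := by rw [hu]; exact hLC
  have hlat := IsNeronLatticeOf.lattice_eq_mulLeft_of_smul u hLT hLC'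
  have hu2 : ((u.u : ℚ)) ^ 2 = r ^ 2 := u_sq_eq_sq_of_smul_quadraticTwist_of_Δ hd u hu hΔ
  have hU : (u.u : ℚ) = r ∨ (u.u : ℚ) = -r := sq_eq_sq_iff_eq_or_eq_neg.mp hu2
  have hr0 : ((r : ℚ) : ℂ) ≠ 0 := by exact_mod_cast hr
  rw [hlat, PeriodPair.mem_mulLeft_lattice, PeriodPair.mem_mulLeft_lattice, inv_inv]
  rcases hU with h1 | h1
  · rw [h1, show G / 2 * ((((r : ℚ) : ℂ))⁻¹ * (2 * ((r : ℚ) : ℂ) * z)) = G * z by field_simp]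
    exact hz
  · rw [h1, Rat.cast_neg, inv_neg,
      show G / 2 * (-(((r : ℚ) : ℂ))⁻¹ * (2 * ((r : ℚ) : ℂ) * z)) = -(G * z) by field_simp, neg_mem_iff]
    exact hz

/-- **The coefficient relation `aₙ(f_{W'}) = χ(n) aₙ(f_W)` along a `χ_d`-orbit for an EVEN-conductor `χ`**
(`C = u • (W ⊗ χ_d)`, `L(C) = L(W')`): at odd `n` the twist relation, at even `n` both sides vanish (`W'`
additive at `2`, `χ(n) = 0`). [cite: Stevens1989, (5.5) p. 97] [cite: SilvermanAEC2009, X.2 and Exercise 10.16] -/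
theorem cuspCoeff_eq_chi_mul_of_twist_even {W W' C : WeierstrassCurve ℚ} [W.IsElliptic] [W'.IsElliptic]
    {N N' : ℕ} [NeZero N] [NeZero N'] {d : ℚ} (hd : d ≠ 0) {m : ℕ} {χ : DirichletCharacter ℂ m}
    (u : VariableChange ℚ) (hu : u • W.quadraticTwist d = C) (hLC : C.LFunction = W'.LFunction)
    (hodd : ∀ n : ℕ, ¬ 2 ∣ n → (((W.quadraticTwist d).LFunction n : ℤ) : ℂ) = χ n * (W.LFunction n : ℂ))
    (heven : ∀ n : ℕ, 2 ∣ n → χ n = 0) (hW'0 : ∀ n : ℕ, 2 ∣ n → W'.LFunction n = 0)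
    (D : ModularParametrizationData W N) (D' : ModularParametrizationData W' N') (n : ℕ) :
    cuspCoeff D'.f n = χ n * cuspCoeff D.f n := by
  haveI := W.isElliptic_quadraticTwist hd
  rw [D'.isNewformOf.2 n, D.isNewformOf.2 n]
  by_cases h2 : 2 ∣ n
  · rw [hW'0 n h2, heven n h2]
    simp
  · rw [← hLC, ← hu, LFunction_smul]
    exact hodd n h2

/-- `p`-adic bookkeeping: `c' ∣ 2c`, `c ≠ 0` ⇒ `v_p(c') ≤ v_p(c) + v_p(2)`. [folklore] -/
theorem padicValInt_le_of_dvd_two_mul {c c' : ℤ} (hc : c ≠ 0) (h : c' ∣ 2 * c) (p : ℕ)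
    [hp : Fact p.Prime] : padicValInt p c' ≤ padicValInt p c + padicValInt p 2 := by
  have h2c : (2 : ℤ) * c ≠ 0 := mul_ne_zero two_ne_zero hc
  have hd : (p : ℤ) ^ padicValInt p c' ∣ 2 * c := dvd_trans (padicValInt_dvd c') h
  rcases (padicValInt_dvd_iff _ _).mp hd with h0 | hle
  · exact absurd h0 h2c
  · rw [padicValInt.mul two_ne_zero hc] at hle
    omega

/-- **E-an-18 `EvenTwistOrbitManinTransport d m` — THEOREM I′ on `Γ₀` (beyond print; PROVED below at
`(d, m) ∈ {(−1, 4), (2, 8), (−2, 8)}`).**  Same conductor `N` with `m² ∣ N`, `C` a globally minimal model of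
`W ⊗ χ_d` ISOGENOUS to `W'`, `D` ANY datum of `W` at level `N`, `D'` the lattice-optimal datum of `W'`:
`Δ(C) = d⁶Δ(W)` (`ũ = 1`) ⟹ `c(D') ∣ 2·c(D)`; `2¹²Δ(C) = d⁶Δ(W)` (`ũ = 2`) ⟹ `c(D') ∣ 4·c(D)`.  The extra
factor `2` against E-an-9 is the `Γ₀`-defect `g(χ)/√d = 2` at conductor `4`, `8` (Stevens' `η = 2`); the
exact `c(D') = ±c(D)` (E-an-10 THM I) is NOT claimed.  Why it might fail: at the three proved instances it
cannot; for other `(d, m)` it is not asserted. [cite: Stevens1989, Lemma (5.4) p. 97] [cite: Pal2012, Lemma 3.1]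
[cite: SilvermanATAEC1994, Cor. IV.9.1] -/
@[conjecture] def EvenTwistOrbitManinTransport (d : ℤ) (m : ℕ) : Prop :=
  ∀ (W W' C : WeierstrassCurve ℚ) [W.IsElliptic] [W.IsGloballyMinimal] [W'.IsElliptic]
    [W'.IsGloballyMinimal] [C.IsElliptic] [C.IsGloballyMinimal]
    [NeZero (W.conductorNorm ℤ)] [NeZero (W'.conductorNorm ℤ)] (u : VariableChange ℚ)
    (D : ModularParametrizationData W (W.conductorNorm ℤ))
    (D' : ModularParametrizationData W' (W'.conductorNorm ℤ)),
    m ^ 2 ∣ W.conductorNorm ℤ → W'.conductorNorm ℤ = W.conductorNorm ℤ →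
    u • W.quadraticTwist ((d : ℤ) : ℚ) = C → WeierstrassCurve.IsIsogenous C W' →
    (∀ z ∈ D'.L.lattice, ∃ w ∈ periodLattice D'.f, z = D'.c * w) →
    (C.Δ = ((d : ℤ) : ℚ) ^ 6 * W.Δ → D'.c ∣ 2 * D.c) ∧
    ((2 : ℚ) ^ 12 * C.Δ = ((d : ℤ) : ℚ) ^ 6 * W.Δ → D'.c ∣ 4 * D.c)

/-- **E-an-18c `EvenFlipOrbitManinChain d m` — `c′ ∣ 2c ∣ 4c′` on a same-level `χ_d`-orbit (`m² ∣ N`) whose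
two members are both twist-minimal (`Δ(C) = d⁶Δ(W)`, `Δ(C′) = d⁶Δ(W′)`; at `d = −1`: `Δ` constant along the
orbit), both data lattice-optimal.**  PROVED at `(−1, 4)`, `(±2, 8)` (E-an-18 in both directions).
[cite: Stevens1989, Lemma (5.4)] [cite: Pal2012, Lemma 3.1] -/
@[conjecture] def EvenFlipOrbitManinChain (d : ℤ) (m : ℕ) : Prop :=
  ∀ (W W' C C' : WeierstrassCurve ℚ) [W.IsElliptic] [W.IsGloballyMinimal] [W'.IsElliptic]
    [W'.IsGloballyMinimal] [C.IsElliptic] [C.IsGloballyMinimal] [C'.IsElliptic] [C'.IsGloballyMinimal]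
    [NeZero (W.conductorNorm ℤ)] [NeZero (W'.conductorNorm ℤ)] (u u' : VariableChange ℚ)
    (D : ModularParametrizationData W (W.conductorNorm ℤ))
    (D' : ModularParametrizationData W' (W'.conductorNorm ℤ)),
    m ^ 2 ∣ W.conductorNorm ℤ → W'.conductorNorm ℤ = W.conductorNorm ℤ →
    u • W.quadraticTwist ((d : ℤ) : ℚ) = C → WeierstrassCurve.IsIsogenous C W' →
    u' • W'.quadraticTwist ((d : ℤ) : ℚ) = C' → WeierstrassCurve.IsIsogenous C' W →
    (∀ z ∈ D.L.lattice, ∃ w ∈ periodLattice D.f, z = D.c * w) →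
    (∀ z ∈ D'.L.lattice, ∃ w ∈ periodLattice D'.f, z = D'.c * w) →
    C.Δ = ((d : ℤ) : ℚ) ^ 6 * W.Δ → C'.Δ = ((d : ℤ) : ℚ) ^ 6 * W'.Δ →
    D'.c ∣ 2 * D.c ∧ D.c ∣ 2 * D'.c

/-- **E-an-18v `EvenFlipOrbitManinValuation d m` — the valuation reading of E-an-18c:** `v_ℓ(c′) = v_ℓ(c)` for
every odd prime `ℓ` and `|v₂(c′) − v₂(c)| ≤ 1`.  PROVED at `(−1, 4)`, `(±2, 8)`.  Census dictionary: Cremona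
`c = c′ = 1` on all 296 234 same-level `χ₋₄`-orbits `< 5·10⁵` (conjecturally `c′ = ±c`: E-an-10 / E-imc-8).
[cite: Stevens1989, Lemma (5.4)] [cite: Pal2012, Lemma 3.1] -/
@[conjecture] def EvenFlipOrbitManinValuation (d : ℤ) (m : ℕ) : Prop :=
  ∀ (W W' C C' : WeierstrassCurve ℚ) [W.IsElliptic] [W.IsGloballyMinimal] [W'.IsElliptic]
    [W'.IsGloballyMinimal] [C.IsElliptic] [C.IsGloballyMinimal] [C'.IsElliptic] [C'.IsGloballyMinimal]
    [NeZero (W.conductorNorm ℤ)] [NeZero (W'.conductorNorm ℤ)] (u u' : VariableChange ℚ)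
    (D : ModularParametrizationData W (W.conductorNorm ℤ))
    (D' : ModularParametrizationData W' (W'.conductorNorm ℤ)),
    m ^ 2 ∣ W.conductorNorm ℤ → W'.conductorNorm ℤ = W.conductorNorm ℤ →
    u • W.quadraticTwist ((d : ℤ) : ℚ) = C → WeierstrassCurve.IsIsogenous C W' →
    u' • W'.quadraticTwist ((d : ℤ) : ℚ) = C' → WeierstrassCurve.IsIsogenous C' W →
    (∀ z ∈ D.L.lattice, ∃ w ∈ periodLattice D.f, z = D.c * w) →
    (∀ z ∈ D'.L.lattice, ∃ w ∈ periodLattice D'.f, z = D'.c * w) →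
    C.Δ = ((d : ℤ) : ℚ) ^ 6 * W.Δ → C'.Δ = ((d : ℤ) : ℚ) ^ 6 * W'.Δ →
    (∀ ℓ : ℕ, ℓ.Prime → ℓ ≠ 2 → padicValInt ℓ D'.c = padicValInt ℓ D.c) ∧
    padicValInt 2 D'.c ≤ padicValInt 2 D.c + 1 ∧ padicValInt 2 D.c ≤ padicValInt 2 D'.c + 1

/-- **THEOREM I′, generic form.**  For `d ≠ 0`, an even modulus `m = 2k`, a primitive quadratic `χ` mod `m` with
`g(χ)² = 4d` and the odd-`n` coefficient relation `aₙ(X ⊗ χ_d) = χ(n) aₙ(X)` (every elliptic `X`) and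
`χ(n) = 0` at even `n`: `EvenTwistOrbitManinTransport d m`.  The `Γ₀` chain `maninConstant_dvd_mul_of_charTwist_gamma0`
with `r = 2ũ`; `aₙ(W') = 0` at even `n` from `4 ∣ m² ∣ N` (`W'` additive at `2`).
[cite: Stevens1989, Lemma (5.4) p. 97] [cite: Pal2012, Lemma 3.1] [cite: SilvermanATAEC1994, Cor. IV.9.1] -/
theorem evenTwistOrbitManinTransport_of_char {d : ℤ} (hd : d ≠ 0) {k : ℕ} [NeZero k]
    {χ : DirichletCharacter ℂ (2 * k)} (hχ : χ.IsQuadratic) (hprim : χ.IsPrimitive)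
    (hG : gaussSum χ (ZMod.stdAddChar (N := 2 * k)) ^ 2 = 4 * ((d : ℤ) : ℂ))
    (hodd : ∀ (X : WeierstrassCurve ℚ) [X.IsElliptic] (n : ℕ), ¬ 2 ∣ n →
      (((X.quadraticTwist ((d : ℤ) : ℚ)).LFunction n : ℤ) : ℂ) = χ n * (X.LFunction n : ℂ))
    (heven : ∀ n : ℕ, 2 ∣ n → χ n = 0) : EvenTwistOrbitManinTransport d (2 * k) := by
  intro W W' C _ _ _ _ _ _ _ _ u D D' hM hN hu hiso hD'
  haveI : Fact (Nat.Prime 2) := ⟨Nat.prime_two⟩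
  haveI : NeZero (2 * k) := ⟨mul_ne_zero two_ne_zero (NeZero.ne k)⟩
  have hd0 : ((d : ℤ) : ℚ) ≠ 0 := by exact_mod_cast hd
  have hM' : (2 * k) ^ 2 ∣ W'.conductorNorm ℤ := by rw [hN]; exact hM
  have h4' : 2 ^ 2 ∣ W'.conductorNorm ℤ :=
    dvd_trans (pow_dvd_pow_of_dvd (dvd_mul_right 2 k) 2) hM'
  obtain ⟨hngW', hnmW'⟩ := not_good_and_not_mult_of_sq_dvd_conductorNorm W' h4'
  have hW'0 : ∀ n : ℕ, 2 ∣ n → W'.LFunction n = 0 := fun n hn ↦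
    W'.LFunction_apply_eq_zero_of_not_good_of_not_mult 2 hngW' hnmW' hn
  have hG' : gaussSum χ (ZMod.stdAddChar (N := 2 * k)) ^ 2 = 4 * ((((d : ℤ) : ℚ)) : ℂ) := by
    rw [hG]; push_cast; ring
  have hcoef := fun n ↦
    cuspCoeff_eq_chi_mul_of_twist_even hd0 u hu hiso.LFunction_eq (hodd W) heven hW'0 D D' n
  haveI : (C.baseChange ℂ).IsElliptic := by rw [WeierstrassCurve.baseChange]; infer_instance
  obtain ⟨LC, hLC⟩ := exists_isNeronLatticeOf_holds (C.baseChange ℂ)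
  have hNdvd : W.conductorNorm ℤ ∣ W'.conductorNorm ℤ := by rw [hN]
  refine ⟨fun hΔ ↦ ?_, fun hΔ ↦ ?_⟩
  · have hΔ1 : (1 : ℚ) ^ 12 * C.Δ = ((d : ℤ) : ℚ) ^ 6 * W.Δ := by rw [one_pow, one_mul]; exact hΔ
    have hmem : ∀ z : ℂ, gaussSum χ (ZMod.stdAddChar (N := 2 * k)) * z ∈ D.L.lattice →
        ((2 : ℤ) : ℂ) * z ∈ LC.lattice := fun z hz ↦ by
      have h := neronLattice_mem_of_twist_of_gaussSum_sq hd0 u hu one_ne_zero hΔ1 hG' D.isNeronLattice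
        hLC z hz
      push_cast at h ⊢
      simpa using h
    exact maninConstant_dvd_mul_of_charTwist_gamma0 D D' hD' hχ hprim hNdvd hM' hcoef hLC 2 hmem
  · have hmem : ∀ z : ℂ, gaussSum χ (ZMod.stdAddChar (N := 2 * k)) * z ∈ D.L.lattice →
        ((4 : ℤ) : ℂ) * z ∈ LC.lattice := fun z hz ↦ by
      have h := neronLattice_mem_of_twist_of_gaussSum_sq hd0 u hu two_ne_zero hΔ hG' D.isNeronLattice
        hLC z hz
      push_cast at h ⊢
      rw [show (2 : ℂ) * 2 * z = 4 * z by ring] at h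
      exact h
    exact maninConstant_dvd_mul_of_charTwist_gamma0 D D' hD' hχ hprim hNdvd hM' hcoef hLC 4 hmem

/-- **E-an-18c from E-an-18** (both directions of the orbit, clause `ũ = 1` each). -/
theorem evenFlipOrbitManinChain_of_transport {d : ℤ} {m : ℕ} (hT : EvenTwistOrbitManinTransport d m) :
    EvenFlipOrbitManinChain d m := by
  intro W W' C C' _ _ _ _ _ _ _ _ _ _ u u' D D' hM hN hu hiso hu' hiso' hD hD' hΔ hΔ'
  have hM' : m ^ 2 ∣ W'.conductorNorm ℤ := by rw [hN]; exact hM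
  exact ⟨(hT W W' C u D D' hM hN hu hiso hD').1 hΔ, (hT W' W C' u' D' D hM' hN.symm hu' hiso' hD).1 hΔ'⟩

/-- **E-an-18v from E-an-18c** (`v_p(2) = 0` for odd `p`, `= 1` at `p = 2`). -/
theorem evenFlipOrbitManinValuation_of_chain {d : ℤ} {m : ℕ} (hC : EvenFlipOrbitManinChain d m) :
    EvenFlipOrbitManinValuation d m := by
  intro W W' C C' _ _ _ _ _ _ _ _ _ _ u u' D D' hM hN hu hiso hu' hiso' hD hD' hΔ hΔ'
  obtain ⟨h1, h2⟩ := hC W W' C C' u u' D D' hM hN hu hiso hu' hiso' hD hD' hΔ hΔ'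
  have hc : D.c ≠ 0 := D.maninConstant_ne_zero_holds
  have hc' : D'.c ≠ 0 := D'.maninConstant_ne_zero_holds
  refine ⟨fun ℓ hℓ hℓ2 ↦ ?_, ?_, ?_⟩
  · haveI : Fact ℓ.Prime := ⟨hℓ⟩
    have h0 : padicValInt ℓ 2 = 0 := by
      refine padicValInt.eq_zero_of_not_dvd fun h ↦ hℓ2 ?_
      have h' : (ℓ : ℤ) ∣ (2 : ℕ) := by exact_mod_cast h
      exact (Nat.prime_dvd_prime_iff_eq hℓ Nat.prime_two).mp (by exact_mod_cast h')
    have ha := padicValInt_le_of_dvd_two_mul hc h1 ℓ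
    have hb := padicValInt_le_of_dvd_two_mul hc' h2 ℓ
    rw [h0, add_zero] at ha hb
    exact le_antisymm ha hb
  · have h22 : padicValInt 2 (2 : ℤ) = 1 := by simpa using padicValInt_self (p := 2)
    have ha := padicValInt_le_of_dvd_two_mul hc h1 2
    rwa [h22] at ha
  · have h22 : padicValInt 2 (2 : ℤ) = 1 := by simpa using padicValInt_self (p := 2)
    have hb := padicValInt_le_of_dvd_two_mul hc' h2 2
    rwa [h22] at hb

/-- **THEOREM I′ at `χ₋₄`: `EvenTwistOrbitManinTransport (−1) 4`.** [cite: Stevens1989, Lemma (5.4)]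
[cite: Pal2012, Lemma 3.1] [cite: MontgomeryVaughan2007, Thm. 9.17 (PDF p. 232)] -/
theorem evenTwistOrbitManinTransport_negOne : EvenTwistOrbitManinTransport (-1) 4 := by
  haveI : NeZero (2 : ℕ) := ⟨by norm_num⟩
  refine evenTwistOrbitManinTransport_of_char (k := 2) (by norm_num) isQuadratic_χ₄_ringHomComp
    isPrimitive_χ₄_ringHomComp (by rw [gaussSum_χ₄_ringHomComp_sq]; push_cast; ring)
    (fun X _ n hn ↦ ?_) (fun n hn ↦ ?_)
  · rw [show ((-1 : ℤ) : ℚ) = -1 by norm_num, X.LFunction_quadraticTwist_neg_one_apply_of_odd hn,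
      Int.cast_mul, χ₄_ringHomComp_apply_natCast]
  · rw [χ₄_ringHomComp_apply_natCast, ZMod.χ₄_nat_eq_if_mod_four, if_pos (Nat.mod_eq_zero_of_dvd hn)]
    simp

/-- **THEOREM I′ at `χ₈`: `EvenTwistOrbitManinTransport 2 8`.** [cite: Stevens1989, Lemma (5.4)]
[cite: Pal2012, Lemma 3.1] [cite: MontgomeryVaughan2007, Thm. 9.17 (PDF p. 232)] -/
theorem evenTwistOrbitManinTransport_two : EvenTwistOrbitManinTransport 2 8 := by
  haveI : NeZero (4 : ℕ) := ⟨by norm_num⟩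
  refine evenTwistOrbitManinTransport_of_char (k := 4) (by norm_num) isQuadratic_χ₈_ringHomComp
    isPrimitive_χ₈_ringHomComp (by rw [gaussSum_χ₈_ringHomComp_sq]; push_cast; ring)
    (fun X _ n hn ↦ ?_) (fun n hn ↦ ?_)
  · rw [show ((2 : ℤ) : ℚ) = 2 by norm_num, X.LFunction_quadraticTwist_two_apply_of_odd hn,
      Int.cast_mul, χ₈_ringHomComp_apply_natCast]
  · rw [χ₈_ringHomComp_apply_natCast, ZMod.χ₈_nat_eq_if_mod_eight, if_pos (Nat.mod_eq_zero_of_dvd hn)]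
    simp

/-- **THEOREM I′ at `χ₋₈`: `EvenTwistOrbitManinTransport (−2) 8`.** [cite: Stevens1989, Lemma (5.4)]
[cite: Pal2012, Lemma 3.1] [cite: MontgomeryVaughan2007, Thm. 9.17 (PDF p. 232)] -/
theorem evenTwistOrbitManinTransport_negTwo : EvenTwistOrbitManinTransport (-2) 8 := by
  haveI : NeZero (4 : ℕ) := ⟨by norm_num⟩
  refine evenTwistOrbitManinTransport_of_char (k := 4) (by norm_num) isQuadratic_χ₈'_ringHomComp
    isPrimitive_χ₈'_ringHomComp (by rw [gaussSum_χ₈'_ringHomComp_sq]; push_cast; ring)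
    (fun X _ n hn ↦ ?_) (fun n hn ↦ ?_)
  · rw [show ((-2 : ℤ) : ℚ) = -2 by norm_num, X.LFunction_quadraticTwist_neg_two_apply_of_odd hn,
      Int.cast_mul, χ₈'_ringHomComp_apply_natCast]
  · rw [χ₈'_ringHomComp_apply_natCast, ZMod.χ₈'_nat_eq_if_mod_eight, if_pos (Nat.mod_eq_zero_of_dvd hn)]
    simp

end EvenTwist

section ClosedEven

/-! ## §11 Closed obligations for §10 (one per candidate and instance, hypothesis-free `_holds`) -/

/-- **E-an-18 at `χ₋₄` (`d = −1`, `4² ∣ N`).** -/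
@[conjecture] def EvenTwistOrbitManinTransportNegOne : Prop := EvenTwistOrbitManinTransport (-1) 4
/-- `evenTwistOrbitManinTransportNegOne_holds`: the kernel-checked instance closing the statement above (hypothesis-free). -/
theorem evenTwistOrbitManinTransportNegOne_holds : EvenTwistOrbitManinTransportNegOne :=
  evenTwistOrbitManinTransport_negOne

/-- **E-an-18 at `χ₈` (`d = 2`, `8² ∣ N`).** -/
@[conjecture] def EvenTwistOrbitManinTransportTwo : Prop := EvenTwistOrbitManinTransport 2 8
/-- `evenTwistOrbitManinTransportTwo_holds`: the kernel-checked instance closing the statement above (hypothesis-free). -/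
theorem evenTwistOrbitManinTransportTwo_holds : EvenTwistOrbitManinTransportTwo :=
  evenTwistOrbitManinTransport_two

/-- **E-an-18 at `χ₋₈` (`d = −2`, `8² ∣ N`).** -/
@[conjecture] def EvenTwistOrbitManinTransportNegTwo : Prop := EvenTwistOrbitManinTransport (-2) 8
/-- `evenTwistOrbitManinTransportNegTwo_holds`: the kernel-checked instance closing the statement above (hypothesis-free). -/
theorem evenTwistOrbitManinTransportNegTwo_holds : EvenTwistOrbitManinTransportNegTwo :=
  evenTwistOrbitManinTransport_negTwo

/-- **E-an-18c at `χ₋₄`.** -/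
@[conjecture] def EvenFlipOrbitManinChainNegOne : Prop := EvenFlipOrbitManinChain (-1) 4
/-- `evenFlipOrbitManinChainNegOne_holds`: the kernel-checked instance closing the statement above (hypothesis-free). -/
theorem evenFlipOrbitManinChainNegOne_holds : EvenFlipOrbitManinChainNegOne :=
  evenFlipOrbitManinChain_of_transport evenTwistOrbitManinTransport_negOne

/-- **E-an-18c at `χ₈`.** -/
@[conjecture] def EvenFlipOrbitManinChainTwo : Prop := EvenFlipOrbitManinChain 2 8
/-- `evenFlipOrbitManinChainTwo_holds`: the kernel-checked instance closing the statement above (hypothesis-free). -/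
theorem evenFlipOrbitManinChainTwo_holds : EvenFlipOrbitManinChainTwo :=
  evenFlipOrbitManinChain_of_transport evenTwistOrbitManinTransport_two

/-- **E-an-18c at `χ₋₈`.** -/
@[conjecture] def EvenFlipOrbitManinChainNegTwo : Prop := EvenFlipOrbitManinChain (-2) 8
/-- `evenFlipOrbitManinChainNegTwo_holds`: the kernel-checked instance closing the statement above (hypothesis-free). -/
theorem evenFlipOrbitManinChainNegTwo_holds : EvenFlipOrbitManinChainNegTwo :=
  evenFlipOrbitManinChain_of_transport evenTwistOrbitManinTransport_negTwo

/-- **E-an-18v at `χ₋₄`.** -/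
@[conjecture] def EvenFlipOrbitManinValuationNegOne : Prop := EvenFlipOrbitManinValuation (-1) 4
/-- `evenFlipOrbitManinValuationNegOne_holds`: the kernel-checked instance closing the statement above (hypothesis-free). -/
theorem evenFlipOrbitManinValuationNegOne_holds : EvenFlipOrbitManinValuationNegOne :=
  evenFlipOrbitManinValuation_of_chain (evenFlipOrbitManinChain_of_transport evenTwistOrbitManinTransport_negOne)

/-- **E-an-18v at `χ₈`.** -/
@[conjecture] def EvenFlipOrbitManinValuationTwo : Prop := EvenFlipOrbitManinValuation 2 8
/-- `evenFlipOrbitManinValuationTwo_holds`: the kernel-checked instance closing the statement above (hypothesis-free). -/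
theorem evenFlipOrbitManinValuationTwo_holds : EvenFlipOrbitManinValuationTwo :=
  evenFlipOrbitManinValuation_of_chain (evenFlipOrbitManinChain_of_transport evenTwistOrbitManinTransport_two)

/-- **E-an-18v at `χ₋₈`.** -/
@[conjecture] def EvenFlipOrbitManinValuationNegTwo : Prop := EvenFlipOrbitManinValuation (-2) 8
/-- `evenFlipOrbitManinValuationNegTwo_holds`: the kernel-checked instance closing the statement above (hypothesis-free). -/
theorem evenFlipOrbitManinValuationNegTwo_holds : EvenFlipOrbitManinValuationNegTwo :=
  evenFlipOrbitManinValuation_of_chain (evenFlipOrbitManinChain_of_transport evenTwistOrbitManinTransport_negTwo)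

end ClosedEven

end Summit.BirchSwinnertonDyer.Rank1Residual.ManinAdditive

end
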